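/-
Copyright (c) 2026 the pub-hodgecm-mathlib formalisation cell (harness21).  Prover seat hodgecm-mathlib-K2Liu-p23 (g3), Track B «K2-LIT»,
#184♮ = hLiu418 = `stmt-HodgeConjecture-24832`; sockets #41 ∕ K1-a♮ ((Iw-S₀) letter), RULING M-160g «(T-fin)» (LEAD F0P6-plan (g15) BATCH #247, 2026-09-05T01:56:49Z;
K1a desk K2E5-p16 (g8) RULING 01:53:37Z): THE MONOTONE TRANSPORT OF STANDARD SIEGEL SECTION FAMILIES ALONG AN INCLUSION OF IWASAWA DATA `𝒦′.K ≤ 𝒦.K`.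
KERNEL: theorems only.
-/
import Summits.HodgeConjecture.HodgeConjecture.Theorems.K2LiuFirstTermIdentityFaceDefs   -- the carriers of sockets #41 ∕ #42F′ (`IsStandardSectionFamily`, `eisensteinFamilyDelta`, `adelicHeightGL`, …)
import Literature.NumberTheory.K2Lit.SiegelStandardIwasawaData                         -- ★ `IwasawaDatum.IsStd` (M-155j (P0)–(P2))
import HarnessLib

/-!
# Crux `HLiu418`, sockets #41 ∕ K1-a♮, RULING M-160g (T-fin): STANDARD SECTION FAMILIES ARE MONOTONE IN THE IWASAWA DATUM — `𝒦′.K ≤ 𝒦.K` ⇒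
# «standard for `𝒦`» ⇒ «standard for `𝒦′`», hence every `𝒦`-free conclusion proved AT `𝒦′` holds AT `𝒦`

Cell `hodgecm-mathlib`, crux item hLiu418 = `stmt-HodgeConjecture-24832` (helper lane `--supports stmt-HodgeConjecture-24832 --as helper`, count-neutral; closes
no socket).  THEOREMS ONLY (no `def`, no `instance`, no `notation`, no named-fact hypothesis, no `sorry`).

WHY (RULING M-160g, K1a desk K2E5-p16 (g8) 01:53:37Z).  The (Iw-S₀) letter of K1-a♮ (local Iwasawa at the places of `S₀` + flatness of the family on the SAME local
compact, ★ p863501's `K₀ hK₀ hIw hflat`) is payable at Iwasawa data whose finite part is a PRODUCT of flag-transitive local compacts (the datum of record ★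
`K2LiuIwasawaDatumNonempty` and its adapted levels ★ `K2LiuIwasawaDatumAdapted`), not at an arbitrary standard `𝒦` (★ `IwasawaDatum.IsStd`: `K = C_∞ × C_f` with
`C_f` merely OPEN).  The sockets quantify `∀ 𝒦, 𝒦.IsStd → …`.  THIS FILE is the honest bridge: for ANY two Iwasawa data with `𝒦′.K ≤ 𝒦.K`
(★ `IsStandardSectionFamily 𝒦 χ f` = holomorphic family ∧ `𝒦.K`-finite ∧ flat on `𝒦.K`), a `𝒦`-standard family is `𝒦′`-standard — the span of the right
`𝒦′.K`-translates sits inside the span of the right `𝒦.K`-translates, and flatness restricts — so every statement «∀ f standard for `𝒦′`, C f» with `C` not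
mentioning the datum gives the same statement for `𝒦`.  WHAT THIS FILE DOES NOT DO (census 01:58:43Z, reported): it does NOT produce a standard SUB-datum with
product finite part inside a given standard `𝒦` — a principal-congruence product sub-level `∏_v K_v(𝔭_v^{n_v}) ≤ C_f` is NOT an `IwasawaDatum` (the global
Iwasawa decomposition `H(𝔸) = P_Δ(𝔸)·K′` fails for proper congruence levels: in `GL₂(ℚ_p)` already `!![0,1;1,0] ∉ B·K(p^m)`), so the existence of the
sub-datum is carried BY VALUE (`hsub`) in §3, for the LEAD ∕ K1a desk to discharge on the class of record or to book.
* §1 MONOTONICITY: `rightTranslateSpan_mono`, **`kFinite_of_le`**, **`isStandardSectionFamily_of_le`**.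
* §2 TRANSPORT OF ANY DATUM-FREE CONCLUSION: **`forall_standard_of_le`**; the #41-shape instance **`continuation_of_sublevel`** (★ socket #41's body — the
  pole-cleared continuation `(P, Es)` with its five clauses — at a fixed `(L, e, dV, dW, λ)`: «at `𝒦′`» ⇒ «at `𝒦`»; bytes = ★ `K2LiuFaceGAssemblerDirected`'s `h41`
  binder :94–:104 at the datum).
* §3 THE CLASS FORM: **`forall_isStd_of_forall_sub`** — from «#41-shape at every datum of a class `Cl`» and the by-value letter
  `hsub : ∀ 𝒦, 𝒦.IsStd → ∃ 𝒦′, Cl 𝒦′ ∧ 𝒦′.K ≤ 𝒦.K` to «#41-shape at every standard `𝒦`» (`Cl` abstract: at the tie «finite part a product of flag-transitive local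
  compacts, (Iw-S₀) by name»).
References: [Tan1999] §1 p. 166 (standard sections, `K = K_∞ ∏ K_v`); [HarrisKudlaSweet1996] §1 (1.15)–(1.17); [KudlaRallis1994] §1; [BorelJacquet1979] §4.1
(`K`-finiteness) — citations only; the file is three lines of linear algebra over ★ `SiegelStandardSections`.
HONEST LABEL.  Count-neutral helper: `HC_CM` is proved only modulo the 7 printed citations (2 remaining named inputs: hLiu418 = `stmt-HodgeConjecture-24832`,
h413 = `stmt-HodgeConjecture-24833`) until rung 0 closes; this file closes no socket and does not assert the existence of any sub-datum.
-/

set_option autoImplicit false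
set_option linter.dupNamespace false -- the mandated namespace repeats `HodgeConjecture.HodgeConjecture`

noncomputable section

open scoped Matrix Topology
open NumberField IsDedekindDomain
open Literature.NumberTheory.Automorphic Literature.NumberTheory.Automorphic.UnitaryGroup Literature.NumberTheory.GaloisRepresentations
open Literature.NumberTheory.GelbartRogawski1991 Literature.NumberTheory.GelbartRogawski1991.GRConstruction
open Literature.NumberTheory.GelbartRogawski1991.UnitaryDualPair
open Literature.NumberTheory.K2Lit.SiegelDoubled
open Literature.NumberTheory.Automorphic.IdeleClassGroup

namespace Summit.HodgeConjecture.HodgeConjecture.Cruxes.HLiu418.K2LiuSiegelSectionFiniteLevelTransport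

variable {L : Type} [Field L] [NumberField L] [IsCMField L] {N M n : ℕ} {e : Fin N × Fin M ≃ Fin n}
  {dV : Fin N → L} {hdV : ∀ i, IsCMField.complexConj L (dV i) = dV i}
  {dW : Fin M → L} {hdW : ∀ i, IsCMField.complexConj L (dW i) = dW i}

/-! ## §1 Monotonicity in the Iwasawa datum -/

/-- the span of the right `𝒦′.K`-translates of `φ` lies in the span of its right `𝒦.K`-translates when `𝒦′.K ≤ 𝒦.K`. [cite: BorelJacquet1979, §4.1] -/
theorem rightTranslateSpan_mono {𝒦' 𝒦 : IwasawaDatum L e dV hdV dW hdW} (hK : 𝒦'.K ≤ 𝒦.K) (φ : HA L e dV hdV dW hdW → ℂ) :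
    rightTranslateSpan 𝒦' φ ≤ rightTranslateSpan 𝒦 φ := by
  refine Submodule.span_le.2 ?_
  rintro _ ⟨k, rfl⟩
  exact rightTranslate_mem_rightTranslateSpan 𝒦 φ (hK k.2)

/-- **`K`-FINITENESS IS MONOTONE**: a `𝒦.K`-finite function is `𝒦′.K`-finite for every `𝒦′.K ≤ 𝒦.K`. [cite: BorelJacquet1979, §4.1] [cite: Tan1999, §1 p. 166] -/
theorem kFinite_of_le {𝒦' 𝒦 : IwasawaDatum L e dV hdV dW hdW} (hK : 𝒦'.K ≤ 𝒦.K) {φ : HA L e dV hdV dW hdW → ℂ} (hφ : Literature.NumberTheory.K2Lit.SiegelDoubled.IsKFinite 𝒦 φ) :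
    Literature.NumberTheory.K2Lit.SiegelDoubled.IsKFinite 𝒦' φ := by
  unfold Literature.NumberTheory.K2Lit.SiegelDoubled.IsKFinite at hφ ⊢
  haveI := hφ
  exact Submodule.finiteDimensional_of_le (rightTranslateSpan_mono hK φ)

/-- **STANDARD FAMILIES ARE MONOTONE IN THE DATUM**: a family of Siegel sections standard for `𝒦` (holomorphic, `𝒦.K`-finite, flat on `𝒦.K`) is standard for
every Iwasawa datum `𝒦′` with `𝒦′.K ≤ 𝒦.K` (holomorphy is datum-free; `K`-finiteness is monotone; flatness restricts).
[cite: Tan1999, §1 p. 166] [cite: HarrisKudlaSweet1996, §1 (1.15)–(1.17)] [cite: KudlaRallis1994, §1] -/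
theorem isStandardSectionFamily_of_le {𝒦' 𝒦 : IwasawaDatum L e dV hdV dW hdW} (hK : 𝒦'.K ≤ 𝒦.K) {χ : HeckeCharacter L}
    {f : ℂ → HA L e dV hdV dW hdW → ℂ} (hf : IsStandardSectionFamily 𝒦 χ f) : IsStandardSectionFamily 𝒦' χ f :=
  ⟨hf.1, fun s => kFinite_of_le hK (hf.2.1 s), fun k hk s s' => hf.2.2 k (hK hk) s s'⟩

/-! ## §2 Transport of any datum-free conclusion along `𝒦′.K ≤ 𝒦.K` -/

/-- **TRANSPORT**: if every `𝒦′`-standard family satisfies a property `C` that does not mention the datum, then so does every `𝒦`-standard family, for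
`𝒦′.K ≤ 𝒦.K`. [cite: Tan1999, §1 p. 166] [cite: BorelJacquet1979, §4.1] -/
theorem forall_standard_of_le {𝒦' 𝒦 : IwasawaDatum L e dV hdV dW hdW} (hK : 𝒦'.K ≤ 𝒦.K) {χ : HeckeCharacter L}
    {C : (ℂ → HA L e dV hdV dW hdW → ℂ) → Prop} (h : ∀ f, IsStandardSectionFamily 𝒦' χ f → C f) :
    ∀ f, IsStandardSectionFamily 𝒦 χ f → C f :=
  fun f hf => h f (isStandardSectionFamily_of_le hK hf)

/-- **THE #41-SHAPE INSTANCE («(T-fin)» of RULING M-160g)**: socket #41's conclusion — a pole-cleared continuation `(P, Es)` of the doubled Siegel Eisenstein family,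
holomorphic and continuous on `0 < re s`, left `ratH`-invariant, equal to `(∏_{p∈P} (s − p))·E^Δ(s, f)` on `n/2 < re s`, of polynomial growth in the adelic height
locally uniformly in `s` — at a fixed `(L, e, dV, dW, λ)`: if it holds for every continuous standard family of an Iwasawa datum `𝒦′`, it holds for every continuous
standard family of every `𝒦` with `𝒦′.K ≤ 𝒦.K` (bytes of the conclusion = ★ `K2LiuFaceGAssemblerDirected`'s `h41` binder at the datum).
[cite: Tan1999, §1 p. 166, §4] [cite: KudlaRallis1994, §1 Thm. 1.1] [cite: HarrisKudlaSweet1996, §1 (1.15)–(1.17)] -/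
theorem continuation_of_sublevel {n : ℕ} {e : Fin 2 × Fin 1 ≃ Fin n}
    {dV : Fin 2 → L} {hdV : ∀ i, IsCMField.complexConj L (dV i) = dV i}
    {dW : Fin 1 → L} {hdW : ∀ i, IsCMField.complexConj L (dW i) = dW i}
    (lam : Literature.NumberTheory.Automorphic.IdeleClassGroup L →ₜ* Circle)
    {𝒦' 𝒦 : IwasawaDatum L e dV hdV dW hdW} (hK : 𝒦'.K ≤ 𝒦.K)
    (h41' : ∀ f : ℂ → HA L e dV hdV dW hdW → ℂ,
        IsStandardSectionFamily 𝒦' (toHeckeCharacter L lam⁻¹) f → (∀ s, Continuous (f s)) →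
      ∃ (P : Finset ℂ) (Es : ℂ → HA L e dV hdV dW hdW → ℂ),
        (∀ h : HA L e dV hdV dW hdW, DifferentiableOn ℂ (fun s => Es s h) {s : ℂ | 0 < s.re}) ∧
        (∀ s : ℂ, 0 < s.re → Continuous (Es s)) ∧
        (∀ s : ℂ, 0 < s.re → ∀ (γ : ratH L e dV hdV dW hdW) (h : HA L e dV hdV dW hdW),
          Es s ((γ : HA L e dV hdV dW hdW) * h) = Es s h) ∧
        (∀ (s : ℂ) (h : HA L e dV hdV dW hdW), (n : ℝ) / 2 < s.re →
          Es s h = (∏ p ∈ P, (s - p)) * eisensteinFamilyDelta L e dV hdV dW hdW f s h) ∧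
        (∀ z : ℂ, 0 < z.re → ∃ C A r : ℝ, 0 < r ∧ ∀ s : ℂ, dist s z < r → ∀ h : HA L e dV hdV dW hdW,
          ‖Es s h‖ ≤ C * adelicHeightGL (n + n) L (h : GL (Fin (n + n)) (AdeleRing (𝓞 L) L)) ^ A)) :
    ∀ f : ℂ → HA L e dV hdV dW hdW → ℂ,
        IsStandardSectionFamily 𝒦 (toHeckeCharacter L lam⁻¹) f → (∀ s, Continuous (f s)) →
      ∃ (P : Finset ℂ) (Es : ℂ → HA L e dV hdV dW hdW → ℂ),
        (∀ h : HA L e dV hdV dW hdW, DifferentiableOn ℂ (fun s => Es s h) {s : ℂ | 0 < s.re}) ∧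
        (∀ s : ℂ, 0 < s.re → Continuous (Es s)) ∧
        (∀ s : ℂ, 0 < s.re → ∀ (γ : ratH L e dV hdV dW hdW) (h : HA L e dV hdV dW hdW),
          Es s ((γ : HA L e dV hdV dW hdW) * h) = Es s h) ∧
        (∀ (s : ℂ) (h : HA L e dV hdV dW hdW), (n : ℝ) / 2 < s.re →
          Es s h = (∏ p ∈ P, (s - p)) * eisensteinFamilyDelta L e dV hdV dW hdW f s h) ∧
        (∀ z : ℂ, 0 < z.re → ∃ C A r : ℝ, 0 < r ∧ ∀ s : ℂ, dist s z < r → ∀ h : HA L e dV hdV dW hdW,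
          ‖Es s h‖ ≤ C * adelicHeightGL (n + n) L (h : GL (Fin (n + n)) (AdeleRing (𝓞 L) L)) ^ A) :=
  fun f hf hc => h41' f (isStandardSectionFamily_of_le hK hf) hc

/-! ## §3 The class form: from a class `Cl` of data where the letters are paid, to every standard datum, by value of the sub-datum letter `hsub` -/

/-- **FROM A CLASS OF DATA TO EVERY STANDARD DATUM** (the (T-fin) head the LEAD re-cuts to, hypothesis-first): if a datum-free property of standard families holds
at every Iwasawa datum of a class `Cl` (at the tie: finite part a PRODUCT of flag-transitive local compacts, where (Iw-S₀) is by name), and every STANDARD datum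
`𝒦` contains such a datum (`hsub`, BY VALUE — NOT asserted here: proper congruence product levels are not Iwasawa data), then the property holds at every standard
`𝒦`. [cite: Tan1999, §1 p. 166] [cite: BorelJacquet1979, §4.1] -/
theorem forall_isStd_of_forall_sub (Cl : IwasawaDatum L e dV hdV dW hdW → Prop) {χ : HeckeCharacter L}
    {C : (ℂ → HA L e dV hdV dW hdW → ℂ) → Prop}
    (hCl : ∀ 𝒦' : IwasawaDatum L e dV hdV dW hdW, Cl 𝒦' → ∀ f, IsStandardSectionFamily 𝒦' χ f → C f)
    (hsub : ∀ 𝒦 : IwasawaDatum L e dV hdV dW hdW, 𝒦.IsStd → ∃ 𝒦' : IwasawaDatum L e dV hdV dW hdW, Cl 𝒦' ∧ 𝒦'.K ≤ 𝒦.K) :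
    ∀ 𝒦 : IwasawaDatum L e dV hdV dW hdW, 𝒦.IsStd → ∀ f, IsStandardSectionFamily 𝒦 χ f → C f := by
  intro 𝒦 h𝒦
  obtain ⟨𝒦', hCl', hK⟩ := hsub 𝒦 h𝒦
  exact forall_standard_of_le hK (hCl 𝒦' hCl')

/-- the same with the class `Cl` itself required to consist of standard data (`𝒦′.IsStd ∧ Cl 𝒦′`), the shape in which the sockets' producers state their heads.
[cite: Tan1999, §1 p. 166] -/
theorem forall_isStd_of_forall_isStd_sub (Cl : IwasawaDatum L e dV hdV dW hdW → Prop) {χ : HeckeCharacter L}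
    {C : (ℂ → HA L e dV hdV dW hdW → ℂ) → Prop}
    (hCl : ∀ 𝒦' : IwasawaDatum L e dV hdV dW hdW, 𝒦'.IsStd → Cl 𝒦' → ∀ f, IsStandardSectionFamily 𝒦' χ f → C f)
    (hsub : ∀ 𝒦 : IwasawaDatum L e dV hdV dW hdW, 𝒦.IsStd →
      ∃ 𝒦' : IwasawaDatum L e dV hdV dW hdW, 𝒦'.IsStd ∧ Cl 𝒦' ∧ 𝒦'.K ≤ 𝒦.K) :
    ∀ 𝒦 : IwasawaDatum L e dV hdV dW hdW, 𝒦.IsStd → ∀ f, IsStandardSectionFamily 𝒦 χ f → C f := by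
  intro 𝒦 h𝒦
  obtain ⟨𝒦', h𝒦', hCl', hK⟩ := hsub 𝒦 h𝒦
  exact forall_standard_of_le hK (hCl 𝒦' h𝒦' hCl')

end Summit.HodgeConjecture.HodgeConjecture.Cruxes.HLiu418.K2LiuSiegelSectionFiniteLevelTransport

end
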